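import Summits.CriticalPhenomena.PercolationContinuityZ3.Theorems.PercNearOneGluingNoHeavyLowerTailSahiCombSigmaStratumFpGq

/-!
# The Σ certificate has trivial kernel on the stratum `G_∅ = G_p` (a = 2, `F` arbitrary) — one bottom equality suffices

Support file of the one-cut programme (crux `NoHeavyLowerTail`, stmt-CriticalPhenomena-4575; TRI lane of cell `prim-masterthm`; seat prim-lf-1 gen 27;
the proof is a human transcription (and simplification) of prim-lf-1 gen 21's type-level engine run `code/gen21/abstract.py` on this stratum,
memo `FROM-prim-lf-1-gen21-CLOSURE.md` §5, completed from the partial derivation `code/gen26/stratum_G0Gp_proofnotes.md`).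

Setting: the two-copy certificate Σ of `…SahiCombTriWCertificate` (`certSigmaWeight`) at `a = 2`, `P = univ`, in the function language of
`…TriWCertificateClasses` / `…FiveUpSetRankZ3`, on the STRATUM where the `G`-family does not see the coordinate `p` at the bottom and the
`F`-family is ARBITRARY: `F_∅ = A ⊆ F_p = B ⊆ F_⊤ = J`, `A ⊆ F_q = C ⊆ J` (`B`, `C` incomparable) and `G_∅ = G_p = D ⊆ G_q = E ⊆ G_⊤ = H`
(seven up-sets).  Token classes (supports): `L_∅ ⊆ A ∩ refl H`, `L_p ⊆ B ∩ refl E`, `L_q ⊆ C ∩ refl D`, `L_⊤ ⊆ J ∩ refl D`;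
`R_∅ ⊆ refl A ∩ H`, `R_p ⊆ refl B ∩ E`, `R_q ⊆ refl C ∩ D`, `R_⊤ ⊆ refl J ∩ D`; `K_∅ ⊆ refl(A ∩ D)`, `K_p ⊆ refl(B ∩ D)`, `K_q ⊆ refl(C ∩ E)`,
`K_⊤ ⊆ refl(J ∩ H)`; supply fibres `U_∅ = A ∩ D`, `U_p = B ∩ D`, `U_q = C ∩ E`, `U_⊤ = J ∩ H`; local tags from `T4_∅ = refl(A ∩ H)`,
`T4_p = refl(B ∩ E)`, `T4_q = refl(C ∩ D)`, `T4_⊤ = refl(J ∩ D)`.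

* **`FiveUpSet.sigma_kernel_eq_zero_stratum_G0Gp`** — if twelve coefficient vectors with these supports satisfy the eight Σ fibre equations
  (copy 1: `L_∅,L_⊤,R_∅,R_p,R_q,K_∅,K_⊤`; copy 2: `L_∅,L_p,L_q,R_p,R_q,R_⊤,K_p,K_q`, each class seen by the fibres `y ⊇ x`) and the four local tag
  equations, then all twelve vanish.
PROOF (ten phases; Z = zeta sum `zsum`, Ĥ = co-zeta sum; tools: point support, C2′ `eq_zero_of_zsum_eq_zero_on`, (T1) and its dual and Möbius
peeling from `…SahiCombZetaCozeta`, co-zeta support and peeling on the support from `…SahiCombSigmaStratumFpGq`): (0) tags: `K_∅ = K_p = 0`,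
`K_q` lives on `refl((C∖A) ∩ (E∖D))`, `K_⊤` on `refl(J∩H ∖ (A ∪ D ∪ B∩E))`; (1) `K_q = 0` (hat forms of the two `q`-fibre equations, peeling);
(2) `R_q = 0` (Ĥ R_q = 0 on `refl D` by three cases, dual T1, C2′); (3) `L_q = 0` (copy-2 fibre `q` on `C ∩ D`); then `Z L_∅ = 0` on `E` and
`Z R_p = 0` on `D`; (4) `R_⊤ = 0` (copy-2 top and `p` fibres on `J ∩ D`); (5) `K_⊤ = 0` (hat forms of both top equations on the live support, two
cases, peeling); (6) `R_∅ = 0` (Ĥ R_∅ = 0 on `refl H`, dual T1, C2′); (7) `R_p = 0` (Ĥ R_p = 0 on `refl E`); (8) `L_⊤ = 0`, (9) `L_p = 0`,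
(10) `L_∅ = 0` (C2′ on the top equations).
WHY IT MATTERS: P5 gen 15 showed that on this stratum `TRI_W(2) ≥ 0` has NO pointwise / type-LP certificate (LP value −1/12); with ONE equality
(`G_∅ = G_p`, `F` free) it strictly contains the stratum `F_∅ = F_p, G_∅ = G_q` of `…SigmaStratumFpGq` (up to the coordinate swap) and is, by
prim-lf-1 gen 21's engine census, the largest stratum on which the Σ support calculus closes (it does NOT close on `G_p = G_⊤` alone).  The
counting bridge to `0 ≤ triW P F G` is the companion file `…SahiCombTriWStratumG0Gp`.
HONEST LABEL: a kernel theorem for one stratum; `CertSigmaKernelZero` and `TriWIneq` remain OPEN. [this work]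
-/

namespace Summit.CriticalPhenomena.PercolationContinuityZ3.Theorems

namespace FiveUpSet

open Finset

variable {α : Type} [DecidableEq α] [Fintype α]

/-- **The Σ-kernel is trivial on the stratum `G_∅ = G_p`.**  Seven up-sets `A ⊆ B ⊆ J`, `A ⊆ C ⊆ J` (`= F_∅, F_p, F_⊤` and `F_q`) and
`D ⊆ E ⊆ H` (`= G_∅ = G_p, G_q, G_⊤`); twelve coefficient vectors with the supports of the classes `L_x, R_x, K_x` (`x = ∅, p, q, ⊤`); the eight
Σ fibre equations (`P = univ`) and the four local tag equations.  Then all coefficient vectors vanish. [this work] -/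
theorem sigma_kernel_eq_zero_stratum_G0Gp (A B C J D E H : Finset (Finset α))
    (hA : IsUpperSet (A : Set (Finset α))) (hB : IsUpperSet (B : Set (Finset α))) (hC : IsUpperSet (C : Set (Finset α)))
    (hJ : IsUpperSet (J : Set (Finset α))) (hD : IsUpperSet (D : Set (Finset α))) (hE : IsUpperSet (E : Set (Finset α)))
    (hH : IsUpperSet (H : Set (Finset α)))
    (hAB : A ⊆ B) (hAC : A ⊆ C) (hBJ : B ⊆ J) (hCJ : C ⊆ J) (hDE : D ⊆ E) (hEH : E ⊆ H)
    (l0 lp lq l1 r0 rp rq r1 k0 kp kq k1 : Finset α → ℚ)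
    (sl0 : ∀ d, l0 d ≠ 0 → d ∈ A ∧ dᶜ ∈ H) (slp : ∀ d, lp d ≠ 0 → d ∈ B ∧ dᶜ ∈ E)
    (slq : ∀ d, lq d ≠ 0 → d ∈ C ∧ dᶜ ∈ D) (sl1 : ∀ d, l1 d ≠ 0 → d ∈ J ∧ dᶜ ∈ D)
    (sr0 : ∀ d, r0 d ≠ 0 → dᶜ ∈ A ∧ d ∈ H) (srp : ∀ d, rp d ≠ 0 → dᶜ ∈ B ∧ d ∈ E)
    (srq : ∀ d, rq d ≠ 0 → dᶜ ∈ C ∧ d ∈ D) (sr1 : ∀ d, r1 d ≠ 0 → dᶜ ∈ J ∧ d ∈ D)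
    (sk0 : ∀ d, k0 d ≠ 0 → dᶜ ∈ A ∧ dᶜ ∈ D) (skp : ∀ d, kp d ≠ 0 → dᶜ ∈ B ∧ dᶜ ∈ D)
    (skq : ∀ d, kq d ≠ 0 → dᶜ ∈ C ∧ dᶜ ∈ E) (sk1 : ∀ d, k1 d ≠ 0 → dᶜ ∈ J ∧ dᶜ ∈ H)
    (e10 : ∀ t, t ∈ A → t ∈ D → zsum l0 t + zsum r0 t + zsum k0 t = 0)
    (e1p : ∀ t, t ∈ B → t ∈ D → zsum l0 t + zsum r0 t + zsum rp t + zsum k0 t = 0)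
    (e1q : ∀ t, t ∈ C → t ∈ E → zsum l0 t + zsum r0 t + zsum rq t + zsum k0 t = 0)
    (e11 : ∀ t, t ∈ J → t ∈ H → zsum l0 t + zsum l1 t + zsum r0 t + zsum rp t + zsum rq t + zsum k0 t + zsum k1 t = 0)
    (e20 : ∀ t, t ∈ A → t ∈ D → zsum l0 t = 0)
    (e2p : ∀ t, t ∈ B → t ∈ D → zsum l0 t + zsum lp t + zsum rp t + zsum kp t = 0)
    (e2q : ∀ t, t ∈ C → t ∈ E → zsum l0 t + zsum lq t + zsum rq t + zsum kq t = 0)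
    (e21 : ∀ t, t ∈ J → t ∈ H → zsum l0 t + zsum lp t + zsum lq t + zsum rp t + zsum rq t + zsum r1 t + zsum kp t + zsum kq t = 0)
    (tg0 : ∀ e, eᶜ ∈ A → eᶜ ∈ H → k0 e + kp e + kq e + k1 e = 0)
    (tgp : ∀ e, eᶜ ∈ B → eᶜ ∈ E → kp e + k1 e = 0)
    (tgq : ∀ e, eᶜ ∈ C → eᶜ ∈ D → kq e + k1 e = 0)
    (tg1 : ∀ e, eᶜ ∈ J → eᶜ ∈ D → k1 e = 0) :
    (∀ d, l0 d = 0) ∧ (∀ d, lp d = 0) ∧ (∀ d, lq d = 0) ∧ (∀ d, l1 d = 0) ∧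
    (∀ d, r0 d = 0) ∧ (∀ d, rp d = 0) ∧ (∀ d, rq d = 0) ∧ (∀ d, r1 d = 0) ∧
    (∀ d, k0 d = 0) ∧ (∀ d, kp d = 0) ∧ (∀ d, kq d = 0) ∧ (∀ d, k1 d = 0) := by
  have hAJ : A ⊆ J := hAB.trans hBJ
  have hDH : D ⊆ H := hDE.trans hEH
  -- ===== Phase 0: the tags kill K_∅, K_p and confine K_q, K_⊤ =====
  have hk1JD : ∀ e, eᶜ ∈ J → eᶜ ∈ D → k1 e = 0 := tg1
  have hkqCD : ∀ e, eᶜ ∈ C → eᶜ ∈ D → kq e = 0 := by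
    intro e hC' hD'
    have h := tgq e hC' hD'
    rw [hk1JD e (hCJ hC') hD', add_zero] at h
    exact h
  have hkp : ∀ d, kp d = 0 := by
    intro e
    by_contra hne
    obtain ⟨hB', hD'⟩ := skp e hne
    have h := tgp e hB' (hDE hD')
    rw [hk1JD e (hBJ hB') hD', add_zero] at h
    exact hne h
  have hk1BE : ∀ e, eᶜ ∈ B → eᶜ ∈ E → k1 e = 0 := by
    intro e hB' hE'
    have h := tgp e hB' hE'
    rw [hkp e, zero_add] at h
    exact h
  have hk0 : ∀ d, k0 d = 0 := by
    intro e
    by_contra hne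
    obtain ⟨hA', hD'⟩ := sk0 e hne
    have h := tg0 e hA' (hDH hD')
    rw [hkp e, hkqCD e (hAC hA') hD', hk1JD e (hAJ hA') hD', add_zero, add_zero, add_zero] at h
    exact hne h
  have hkqA : ∀ e, eᶜ ∈ A → kq e = 0 := by
    intro e hA'
    by_contra hne
    obtain ⟨hC', hE'⟩ := skq e hne
    by_cases hD' : eᶜ ∈ D
    · exact hne (hkqCD e hC' hD')
    · have h := tg0 e hA' (hEH hE')
      rw [hk0 e, hkp e, hk1BE e (hAB hA') hE', zero_add, zero_add, add_zero] at h
      exact hne h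
  have hk1A : ∀ e, eᶜ ∈ A → k1 e = 0 := by
    intro e hA'
    by_contra hne
    obtain ⟨-, hH'⟩ := sk1 e hne
    have h := tg0 e hA' hH'
    rw [hk0 e, hkp e, hkqA e hA', zero_add, zero_add, zero_add] at h
    exact hne h
  -- live supports of K_q and K_⊤
  have skq' : ∀ e, kq e ≠ 0 → eᶜ ∈ C ∧ eᶜ ∈ E ∧ eᶜ ∉ A ∧ eᶜ ∉ D := by
    intro e hne
    obtain ⟨hC', hE'⟩ := skq e hne
    exact ⟨hC', hE', fun h => hne (hkqA e h), fun h => hne (hkqCD e hC' h)⟩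
  have sk1' : ∀ e, k1 e ≠ 0 → eᶜ ∈ J ∧ eᶜ ∈ H ∧ eᶜ ∉ A ∧ eᶜ ∉ D ∧ ¬ (eᶜ ∈ B ∧ eᶜ ∈ E) := by
    intro e hne
    obtain ⟨hJ', hH'⟩ := sk1 e hne
    exact ⟨hJ', hH', fun h => hne (hk1A e h), fun h => hne (hk1JD e hJ' h), fun h => hne (hk1BE e h.1 h.2)⟩
  have zk0 : ∀ t, zsum k0 t = 0 := zsum_eq_zero_of_forall_eq_zero k0 hk0
  have zkp : ∀ t, zsum kp t = 0 := zsum_eq_zero_of_forall_eq_zero kp hkp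
  -- point supports of the plain zeta sums (function side)
  have nl0 : ∀ t, t ∉ A → zsum l0 t = 0 := fun t ht => zsum_eq_zero_of_not_mem hA l0 (fun d hd => (sl0 d hd).1) ht
  have nlp : ∀ t, t ∉ B → zsum lp t = 0 := fun t ht => zsum_eq_zero_of_not_mem hB lp (fun d hd => (slp d hd).1) ht
  -- co-zeta supports (transform side)
  have hatr0A : ∀ s, sᶜ ∉ A → ∑ d, r0 d * (if s ⊆ d then (1 : ℚ) else 0) = 0 :=
    fun s hs => cozsum_eq_zero_of_compl_not_mem hA r0 (fun d hd => (sr0 d hd).1) hs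
  have hatrpB : ∀ s, sᶜ ∉ B → ∑ d, rp d * (if s ⊆ d then (1 : ℚ) else 0) = 0 :=
    fun s hs => cozsum_eq_zero_of_compl_not_mem hB rp (fun d hd => (srp d hd).1) hs
  have hatrqC : ∀ s, sᶜ ∉ C → ∑ d, rq d * (if s ⊆ d then (1 : ℚ) else 0) = 0 :=
    fun s hs => cozsum_eq_zero_of_compl_not_mem hC rq (fun d hd => (srq d hd).1) hs
  have hatlqD : ∀ s, sᶜ ∉ D → ∑ d, lq d * (if s ⊆ d then (1 : ℚ) else 0) = 0 :=
    fun s hs => cozsum_eq_zero_of_compl_not_mem hD lq (fun d hd => (slq d hd).2) hs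
  have hatl1D : ∀ s, sᶜ ∉ D → ∑ d, l1 d * (if s ⊆ d then (1 : ℚ) else 0) = 0 :=
    fun s hs => cozsum_eq_zero_of_compl_not_mem hD l1 (fun d hd => (sl1 d hd).2) hs
  have hatlpE : ∀ s, sᶜ ∉ E → ∑ d, lp d * (if s ⊆ d then (1 : ℚ) else 0) = 0 :=
    fun s hs => cozsum_eq_zero_of_compl_not_mem hE lp (fun d hd => (slp d hd).2) hs
  -- Z L_∅ = 0 on D (copy-2 fibre ∅ on A ∩ D, point support off A), and its hat form
  have zl0D : ∀ t, t ∈ D → zsum l0 t = 0 := by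
    intro t htD
    by_cases htA : t ∈ A
    · exact e20 t htA htD
    · exact nl0 t htA
  have hatl0D : ∀ s, sᶜ ∈ D → ∑ d, l0 d * (if s ⊆ d then (1 : ℚ) else 0) = 0 :=
    fun s hs => cozsum_eq_zero_of_zsum_eq_zero_on hD l0 zl0D hs
  -- hat forms (T1) of the copy-1 fibre equations ∅ (on A ∩ D), p (on B ∩ D), q (on C ∩ E) and of the copy-2 fibre q
  have hADu : IsUpperSet ((A ∩ D : Finset (Finset α)) : Set (Finset α)) := isUpperSet_inter hA hD
  have hBDu : IsUpperSet ((B ∩ D : Finset (Finset α)) : Set (Finset α)) := isUpperSet_inter hB hD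
  have hCEu : IsUpperSet ((C ∩ E : Finset (Finset α)) : Set (Finset α)) := isUpperSet_inter hC hE
  have hJHu : IsUpperSet ((J ∩ H : Finset (Finset α)) : Set (Finset α)) := isUpperSet_inter hJ hH
  have hat10 : ∀ s, sᶜ ∈ A → sᶜ ∈ D →
      ∑ d, l0 d * (if s ⊆ d then (1 : ℚ) else 0) + ∑ d, r0 d * (if s ⊆ d then (1 : ℚ) else 0) = 0 := by
    intro s hsA hsD
    have h := cozsum_eq_zero_of_zsum_eq_zero_on hADu (fun d => l0 d + r0 d) (fun t ht => by
      rw [mem_inter] at ht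
      have := e10 t ht.1 ht.2
      rw [zk0 t] at this
      rw [zsum_add]; linarith) (s := s) (mem_inter.2 ⟨hsA, hsD⟩)
    rwa [cozsum_add] at h
  have hat1p : ∀ s, sᶜ ∈ B → sᶜ ∈ D →
      ∑ d, l0 d * (if s ⊆ d then (1 : ℚ) else 0) + ∑ d, r0 d * (if s ⊆ d then (1 : ℚ) else 0)
        + ∑ d, rp d * (if s ⊆ d then (1 : ℚ) else 0) = 0 := by
    intro s hsB hsD
    have h := cozsum_eq_zero_of_zsum_eq_zero_on hBDu (fun d => (l0 d + r0 d) + rp d) (fun t ht => by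
      rw [mem_inter] at ht
      have := e1p t ht.1 ht.2
      rw [zk0 t] at this
      rw [zsum_add, zsum_add]; linarith) (s := s) (mem_inter.2 ⟨hsB, hsD⟩)
    rwa [cozsum_add, cozsum_add] at h
  have hat1q : ∀ s, sᶜ ∈ C → sᶜ ∈ E →
      ∑ d, l0 d * (if s ⊆ d then (1 : ℚ) else 0) + ∑ d, r0 d * (if s ⊆ d then (1 : ℚ) else 0)
        + ∑ d, rq d * (if s ⊆ d then (1 : ℚ) else 0) = 0 := by
    intro s hsC hsE
    have h := cozsum_eq_zero_of_zsum_eq_zero_on hCEu (fun d => (l0 d + r0 d) + rq d) (fun t ht => by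
      rw [mem_inter] at ht
      have := e1q t ht.1 ht.2
      rw [zk0 t] at this
      rw [zsum_add, zsum_add]; linarith) (s := s) (mem_inter.2 ⟨hsC, hsE⟩)
    rwa [cozsum_add, cozsum_add] at h
  have hat2q : ∀ s, sᶜ ∈ C → sᶜ ∈ E →
      ∑ d, l0 d * (if s ⊆ d then (1 : ℚ) else 0) + ∑ d, lq d * (if s ⊆ d then (1 : ℚ) else 0)
        + ∑ d, rq d * (if s ⊆ d then (1 : ℚ) else 0) + ∑ d, kq d * (if s ⊆ d then (1 : ℚ) else 0) = 0 := by
    intro s hsC hsE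
    have h := cozsum_eq_zero_of_zsum_eq_zero_on hCEu (fun d => ((l0 d + lq d) + rq d) + kq d) (fun t ht => by
      rw [mem_inter] at ht
      have := e2q t ht.1 ht.2
      rw [zsum_add, zsum_add, zsum_add]; linarith) (s := s) (mem_inter.2 ⟨hsC, hsE⟩)
    rwa [cozsum_add, cozsum_add, cozsum_add] at h
  -- ===== Phase 1: K_q = 0 (hat forms of both q-fibre equations on the live support, peeling) =====
  have hkq : ∀ d, kq d = 0 := by
    refine eq_zero_of_cozsum_eq_zero_on_support kq fun s hne => ?_
    obtain ⟨hsC, hsE, hsA, hsD⟩ := skq' s hne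
    have h1 := hat1q s hsC hsE
    have h2 := hat2q s hsC hsE
    rw [hatr0A s hsA] at h1
    rw [hatlqD s hsD] at h2
    linarith
  have zkq : ∀ t, zsum kq t = 0 := zsum_eq_zero_of_forall_eq_zero kq hkq
  -- ===== Phase 2: R_q = 0 (Ĥ R_q = 0 on refl D; dual T1; C2′) =====
  have hatrqD : ∀ s, sᶜ ∈ D → ∑ d, rq d * (if s ⊆ d then (1 : ℚ) else 0) = 0 := by
    intro s hsD
    by_cases hsC : sᶜ ∈ C
    · have h1 := hat1q s hsC (hDE hsD)
      by_cases hsA : sᶜ ∈ A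
      · have h0 := hat10 s hsA hsD
        linarith
      · rw [hatr0A s hsA, hatl0D s hsD] at h1
        linarith
    · exact hatrqC s hsC
  have zrqD : ∀ t, t ∈ D → zsum rq t = 0 := by
    intro t htD
    refine zsum_eq_zero_of_cozsum_eq_zero_on (isLowerSet_refl hD) rq (fun s hs => hatrqD s (mem_refl.1 hs)) ?_
    rw [mem_refl, compl_compl]; exact htD
  have hrq : ∀ d, rq d = 0 :=
    eq_zero_of_zsum_eq_zero_on hD hC rq (fun d hd => ⟨(srq d hd).2, (srq d hd).1⟩) fun t htD _ => zrqD t htD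
  have zrq : ∀ t, zsum rq t = 0 := zsum_eq_zero_of_forall_eq_zero rq hrq
  have hatrq : ∀ s, ∑ d, rq d * (if s ⊆ d then (1 : ℚ) else 0) = 0 := cozsum_eq_zero_of_forall_eq_zero rq hrq
  -- ===== Phase 3: L_q = 0 (copy-2 fibre q on C ∩ D) =====
  have hlq : ∀ d, lq d = 0 := by
    refine eq_zero_of_zsum_eq_zero_on hC hD lq slq fun t htC htD => ?_
    have h := e2q t htC (hDE htD)
    rw [zl0D t htD, zrq t, zkq t] at h
    linarith
  have zlq : ∀ t, zsum lq t = 0 := zsum_eq_zero_of_forall_eq_zero lq hlq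
  -- Z L_∅ = 0 on E (copy-2 fibre q on A ∩ E ⊆ C ∩ E, point support off A), and its hat form
  have zl0E : ∀ t, t ∈ E → zsum l0 t = 0 := by
    intro t htE
    by_cases htA : t ∈ A
    · have h := e2q t (hAC htA) htE
      rw [zlq t, zrq t, zkq t] at h
      linarith
    · exact nl0 t htA
  have hatl0E : ∀ s, sᶜ ∈ E → ∑ d, l0 d * (if s ⊆ d then (1 : ℚ) else 0) = 0 :=
    fun s hs => cozsum_eq_zero_of_zsum_eq_zero_on hE l0 zl0E hs
  -- Z R_p = 0 on D (Ĥ R_p = 0 on refl D by three cases; dual T1)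
  have hatrpD : ∀ s, sᶜ ∈ D → ∑ d, rp d * (if s ⊆ d then (1 : ℚ) else 0) = 0 := by
    intro s hsD
    by_cases hsB : sᶜ ∈ B
    · have h1 := hat1p s hsB hsD
      by_cases hsA : sᶜ ∈ A
      · have h0 := hat10 s hsA hsD
        linarith
      · rw [hatr0A s hsA, hatl0D s hsD] at h1
        linarith
    · exact hatrpB s hsB
  have zrpD : ∀ t, t ∈ D → zsum rp t = 0 := by
    intro t htD
    refine zsum_eq_zero_of_cozsum_eq_zero_on (isLowerSet_refl hD) rp (fun s hs => hatrpD s (mem_refl.1 hs)) ?_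
    rw [mem_refl, compl_compl]; exact htD
  -- ===== Phase 4: R_⊤ = 0 (copy-2 top and p fibres on J ∩ D) =====
  have hr1 : ∀ d, r1 d = 0 := by
    refine eq_zero_of_zsum_eq_zero_on hD hJ r1 (fun d hd => ⟨(sr1 d hd).2, (sr1 d hd).1⟩) fun t htD htJ => ?_
    have h2 := e21 t htJ (hDH htD)
    rw [zl0D t htD, zlq t, zrq t, zkp t, zkq t, zrpD t htD] at h2
    by_cases htB : t ∈ B
    · have hp := e2p t htB htD
      rw [zl0D t htD, zrpD t htD, zkp t] at hp
      linarith
    · rw [nlp t htB] at h2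
      linarith
  have zr1 : ∀ t, zsum r1 t = 0 := zsum_eq_zero_of_forall_eq_zero r1 hr1
  -- hat forms of the two top-fibre equations (on J ∩ H)
  have hat11 : ∀ s, sᶜ ∈ J → sᶜ ∈ H →
      ∑ d, l0 d * (if s ⊆ d then (1 : ℚ) else 0) + ∑ d, l1 d * (if s ⊆ d then (1 : ℚ) else 0)
        + ∑ d, r0 d * (if s ⊆ d then (1 : ℚ) else 0) + ∑ d, rp d * (if s ⊆ d then (1 : ℚ) else 0)
        + ∑ d, k1 d * (if s ⊆ d then (1 : ℚ) else 0) = 0 := by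
    intro s hsJ hsH
    have h := cozsum_eq_zero_of_zsum_eq_zero_on hJHu (fun d => (((l0 d + l1 d) + r0 d) + rp d) + k1 d) (fun t ht => by
      rw [mem_inter] at ht
      have := e11 t ht.1 ht.2
      rw [zrq t, zk0 t] at this
      rw [zsum_add, zsum_add, zsum_add, zsum_add]; linarith) (s := s) (mem_inter.2 ⟨hsJ, hsH⟩)
    rwa [cozsum_add, cozsum_add, cozsum_add, cozsum_add] at h
  have hat21 : ∀ s, sᶜ ∈ J → sᶜ ∈ H →
      ∑ d, l0 d * (if s ⊆ d then (1 : ℚ) else 0) + ∑ d, lp d * (if s ⊆ d then (1 : ℚ) else 0)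
        + ∑ d, rp d * (if s ⊆ d then (1 : ℚ) else 0) = 0 := by
    intro s hsJ hsH
    have h := cozsum_eq_zero_of_zsum_eq_zero_on hJHu (fun d => (l0 d + lp d) + rp d) (fun t ht => by
      rw [mem_inter] at ht
      have := e21 t ht.1 ht.2
      rw [zlq t, zrq t, zr1 t, zkp t, zkq t] at this
      rw [zsum_add, zsum_add]; linarith) (s := s) (mem_inter.2 ⟨hsJ, hsH⟩)
    rwa [cozsum_add, cozsum_add] at h
  -- ===== Phase 5: K_⊤ = 0 (hat forms of both top equations on the live support, peeling) =====
  have hk1 : ∀ d, k1 d = 0 := by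
    refine eq_zero_of_cozsum_eq_zero_on_support k1 fun s hne => ?_
    obtain ⟨hsJ, hsH, hsA, hsD, hsBE⟩ := sk1' s hne
    have h1 := hat11 s hsJ hsH
    rw [hatl1D s hsD, hatr0A s hsA] at h1
    by_cases hsE : sᶜ ∈ E
    · have hsB : sᶜ ∉ B := fun h => hsBE ⟨h, hsE⟩
      rw [hatrpB s hsB, hatl0E s hsE] at h1
      linarith
    · have h2 := hat21 s hsJ hsH
      rw [hatlpE s hsE] at h2
      linarith
  have zk1 : ∀ t, zsum k1 t = 0 := zsum_eq_zero_of_forall_eq_zero k1 hk1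
  have hatk1 : ∀ s, ∑ d, k1 d * (if s ⊆ d then (1 : ℚ) else 0) = 0 := cozsum_eq_zero_of_forall_eq_zero k1 hk1
  -- ===== Phase 6: R_∅ = 0 (Ĥ R_∅ = 0 on refl H by three cases; dual T1; C2′) =====
  have hatr0H : ∀ s, sᶜ ∈ H → ∑ d, r0 d * (if s ⊆ d then (1 : ℚ) else 0) = 0 := by
    intro s hsH
    by_cases hsA : sᶜ ∈ A
    · by_cases hsE : sᶜ ∈ E
      · have h := hat1q s (hAC hsA) hsE
        rw [hatl0E s hsE, hatrq s] at h
        linarith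
      · have h1 := hat11 s (hAJ hsA) hsH
        have h2 := hat21 s (hAJ hsA) hsH
        have hsD : sᶜ ∉ D := fun h => hsE (hDE h)
        rw [hatl1D s hsD, hatk1 s] at h1
        rw [hatlpE s hsE] at h2
        linarith
    · exact hatr0A s hsA
  have hr0 : ∀ d, r0 d = 0 := by
    have zr0H : ∀ t, t ∈ H → zsum r0 t = 0 := by
      intro t htH
      refine zsum_eq_zero_of_cozsum_eq_zero_on (isLowerSet_refl hH) r0 (fun s hs => hatr0H s (mem_refl.1 hs)) ?_
      rw [mem_refl, compl_compl]; exact htH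
    exact eq_zero_of_zsum_eq_zero_on hH hA r0 (fun d hd => ⟨(sr0 d hd).2, (sr0 d hd).1⟩) fun t htH _ => zr0H t htH
  have zr0 : ∀ t, zsum r0 t = 0 := zsum_eq_zero_of_forall_eq_zero r0 hr0
  have hatr0 : ∀ s, ∑ d, r0 d * (if s ⊆ d then (1 : ℚ) else 0) = 0 := cozsum_eq_zero_of_forall_eq_zero r0 hr0
  -- ===== Phase 7: R_p = 0 (Ĥ R_p = 0 on refl E; dual T1; C2′) =====
  have hatrpE : ∀ s, sᶜ ∈ E → ∑ d, rp d * (if s ⊆ d then (1 : ℚ) else 0) = 0 := by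
    intro s hsE
    by_cases hsD : sᶜ ∈ D
    · exact hatrpD s hsD
    · by_cases hsB : sᶜ ∈ B
      · have h1 := hat11 s (hBJ hsB) (hEH hsE)
        rw [hatl0E s hsE, hatl1D s hsD, hatr0 s, hatk1 s] at h1
        linarith
      · exact hatrpB s hsB
  have hrp : ∀ d, rp d = 0 := by
    have zrpE : ∀ t, t ∈ E → zsum rp t = 0 := by
      intro t htE
      refine zsum_eq_zero_of_cozsum_eq_zero_on (isLowerSet_refl hE) rp (fun s hs => hatrpE s (mem_refl.1 hs)) ?_
      rw [mem_refl, compl_compl]; exact htE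
    exact eq_zero_of_zsum_eq_zero_on hE hB rp (fun d hd => ⟨(srp d hd).2, (srp d hd).1⟩) fun t htE _ => zrpE t htE
  have zrp : ∀ t, zsum rp t = 0 := zsum_eq_zero_of_forall_eq_zero rp hrp
  -- ===== Phase 8: L_⊤ = 0 (copy-1 top equation on J ∩ D) =====
  have hl1 : ∀ d, l1 d = 0 := by
    refine eq_zero_of_zsum_eq_zero_on hJ hD l1 sl1 fun t htJ htD => ?_
    have h1 := e11 t htJ (hDH htD)
    rw [zl0D t htD, zr0 t, zrp t, zrq t, zk0 t, zk1 t] at h1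
    linarith
  -- ===== Phase 9: L_p = 0 (copy-2 top equation on B ∩ E) =====
  have hlp : ∀ d, lp d = 0 := by
    refine eq_zero_of_zsum_eq_zero_on hB hE lp slp fun t htB htE => ?_
    have h2 := e21 t (hBJ htB) (hEH htE)
    rw [zl0E t htE, zlq t, zrp t, zrq t, zr1 t, zkp t, zkq t] at h2
    linarith
  have zlp : ∀ t, zsum lp t = 0 := zsum_eq_zero_of_forall_eq_zero lp hlp
  -- ===== Phase 10: L_∅ = 0 (copy-2 top equation on A ∩ H) =====
  have hl0 : ∀ d, l0 d = 0 := by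
    refine eq_zero_of_zsum_eq_zero_on hA hH l0 sl0 fun t htA htH => ?_
    have h2 := e21 t (hAJ htA) htH
    rw [zlp t, zlq t, zrp t, zrq t, zr1 t, zkp t, zkq t] at h2
    linarith
  exact ⟨hl0, hlp, hlq, hl1, hr0, hrp, hrq, hr1, hk0, hkp, hkq, hk1⟩

end FiveUpSet

end Summit.CriticalPhenomena.PercolationContinuityZ3.Theorems
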